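/-
Copyright: the b2b-balaban T⁴-continuum CRUX team, row NE7b OWNER lineage `t4-ne7b-p1` (gen 147). Project licence.
-/
import Summits.QuantumFields.BalabanUV.T4Continuum.Spine.NE7b.SupWeightedKernelLetterTransport

/-!
# THE WEIGHTED TRANSPORT AT ORDER THREE IN THE OTHER TWO ROLES ((766) §3 continued; file (768)).  (766) transported the first-index
# full-graph letter of a nonnegative order-3 majorant `K3` through the rescaling `t • J_β` (`K3′ = |t|³Σ_{fibres}K3`, coarse weight with
# `ϑc(βx,βx′) ≤ M·ϑ(x,x′)`): `Σ_{y₂,y₃}K3′(y₁,y₂,y₃)ϑcϑcϑc ≤ |t|³·n·M³·κ₃`.  The class carries the letter in THREE roles (slot shapes of (657)∕(749):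
# `k3rϑ` first index, `k3mϑ` second, `k3cϑ` third).  THIS FILE derives the second- and third-index transports from (766) §3 applied to the
# kernel with permuted arguments (`(a,b,c) ↦ K3 b a c`, `↦ K3 b c a`) — the fibre sums inside `K3′` commute (`Finset.sum_comm`), so the
# coarse majorant is the same object — in the SLOT shapes:
#   `Σ_{y₂,y₃}K3′(y₂,y₁,y₃)·ϑc(y₁,y₂)ϑc(y₁,y₃)ϑc(y₂,y₃) ≤ |t|³·n·M³·κ₃m`,   `Σ_{y₂,y₃}K3′(y₂,y₃,y₁)·ϑc(y₁,y₂)ϑc(y₁,y₃)ϑc(y₂,y₃) ≤ |t|³·n·M³·κ₃c`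
# (row NE7b, node U5c; (766) BY NAME; Mathlib; [folklore]).  With (766) the order-3 letters of the weighted class transport in all three roles;
# orders 4–5: the same two devices (one first-index computation per order, argument permutations for the other roles) — successor.

Cell `pub-balaban`, sub-cell `t4`, spine estimate NE7b (`T4WeightBudget.RelWeightBound`; the cell's OWN estimate — NOT PRINTED in
[Bałaban 1983–89], NOT PROVED).  Crux-route work under `Spine/NE7b/` by the row OWNER (`t4-ne7b-p1` gen 147, file (768)) under FREEZE
(0)'s crux-prover clause; NOTHING of Bałaban's is named as a Lean object, valued or asserted; no `T4Continuum/Support` leaf typed; no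
`def`, no notation; zero `sorry`.  Imports (BY NAME): (766) `…SupWeightedKernelLetterTransport`.

WHAT IS PROVED ([folklore]): `fibre_sum3_swap12`, `fibre_sum3_cycle` (the fibre sums commute), **`weighted_coarse_k3_letter_le_second`**,
**`weighted_coarse_k3_letter_le_third`**; toy.

HONEST (what this is NOT).  Finite-sum bookkeeping (orders 4–5 and the flow of the letter values not typed); scalar skeleton ((A3), NC-NE7b-α
UNRULED); nothing of Bałaban's asserted.  BY-NAME EFFECT ON THE WALL: NONE.  NE7b NOT PRINTED ∕ NOT PROVED; spine PROVED 0∕9; rung (B)+1 —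
the programme's measures remain FINITE-torus statements; NOT the mass gap, NOT Clay.  HONEST DEPENDENCY: continuum YM on T⁴ ⇐ BetaPertH ∧
nine spine estimates (0∕9 proved); BetaPertH ⇐ (D1) ∧ (D4) ∧ CAP+tail; G-an2-4 gates asym, D1 and NE2∕3∕4.
-/

set_option autoImplicit false

noncomputable section

namespace Summit.QuantumFields.BalabanUV.T4Continuum.NE7b.SupWeightedKernelLetterTransportTwo

open Finset
open scoped BigOperators
open SupWeightedKernelLetterTransport (weighted_coarse_k3_letter_le)

variable {ι ι' : Type} [Fintype ι] [Fintype ι'] [DecidableEq ι']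

/-! ## §1. The fibre sums commute -/

omit [Fintype ι'] in
/-- Swap the first two fibre sums. [folklore] -/
theorem fibre_sum3_swap12 (β : ι → ι') (K3 : ι → ι → ι → ℝ) (Y₁ Y₂ Y₃ : ι') :
    ∑ x ∈ Finset.univ.filter (fun x => β x = Y₁), ∑ x' ∈ Finset.univ.filter (fun x' => β x' = Y₂), ∑ x'' ∈ Finset.univ.filter (fun x'' => β x'' = Y₃), K3 x x' x'' =
      ∑ x' ∈ Finset.univ.filter (fun x' => β x' = Y₂), ∑ x ∈ Finset.univ.filter (fun x => β x = Y₁), ∑ x'' ∈ Finset.univ.filter (fun x'' => β x'' = Y₃), K3 x x' x'' :=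
  sum_comm

omit [Fintype ι'] in
/-- Move the last fibre sum to the front. [folklore] -/
theorem fibre_sum3_cycle (β : ι → ι') (K3 : ι → ι → ι → ℝ) (Y₁ Y₂ Y₃ : ι') :
    ∑ x ∈ Finset.univ.filter (fun x => β x = Y₁), ∑ x' ∈ Finset.univ.filter (fun x' => β x' = Y₂), ∑ x'' ∈ Finset.univ.filter (fun x'' => β x'' = Y₃), K3 x x' x'' =
      ∑ x'' ∈ Finset.univ.filter (fun x'' => β x'' = Y₃), ∑ x ∈ Finset.univ.filter (fun x => β x = Y₁), ∑ x' ∈ Finset.univ.filter (fun x' => β x' = Y₂), K3 x x' x'' :=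
  calc ∑ x ∈ Finset.univ.filter (fun x => β x = Y₁), ∑ x' ∈ Finset.univ.filter (fun x' => β x' = Y₂), ∑ x'' ∈ Finset.univ.filter (fun x'' => β x'' = Y₃), K3 x x' x''
      = ∑ x ∈ Finset.univ.filter (fun x => β x = Y₁), ∑ x'' ∈ Finset.univ.filter (fun x'' => β x'' = Y₃), ∑ x' ∈ Finset.univ.filter (fun x' => β x' = Y₂), K3 x x' x'' := sum_congr rfl fun _ _ => sum_comm
    _ = ∑ x'' ∈ Finset.univ.filter (fun x'' => β x'' = Y₃), ∑ x ∈ Finset.univ.filter (fun x => β x = Y₁), ∑ x' ∈ Finset.univ.filter (fun x' => β x' = Y₂), K3 x x' x'' := sum_comm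

/-! ## §2. Second- and third-index transports -/

/-- **ORDER 3, SECOND INDEX FIXED** (the slot shape of `k3mϑ`): fine letter `Σ_{x,v}K3 x y v·ϑ(y,x)ϑ(y,v)ϑ(x,v) ≤ κ₃` (`y` fixed) gives the
coarse letter `Σ_{y₂,y₃}K3′(y₂,y₁,y₃)·ϑc(y₁,y₂)ϑc(y₁,y₃)ϑc(y₂,y₃) ≤ |t|³·n·M³·κ₃`. [folklore] -/
theorem weighted_coarse_k3_letter_le_second (β : ι → ι') {n : ℕ} (hfib : ∀ y, (univ.filter fun x => β x = y).card ≤ n)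
    (K3 : ι → ι → ι → ℝ) (hK : ∀ x y v, 0 ≤ K3 x y v) {ϑ : ι → ι → ℝ} {ϑc : ι' → ι' → ℝ} {M κ₃ : ℝ} (hM : 0 ≤ M) (hϑ0 : ∀ x x', 0 ≤ ϑ x x')
    (hϑc0 : ∀ y y', 0 ≤ ϑc y y') (hϑ : ∀ x x', ϑc (β x) (β x') ≤ M * ϑ x x') (hκ : 0 ≤ κ₃)
    (hk3 : ∀ y, ∑ x, ∑ v, K3 x y v * (ϑ y x * ϑ y v * ϑ x v) ≤ κ₃) (t : ℝ) (y₁ : ι') :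
    ∑ y₂, ∑ y₃, (|t| ^ 3 * ∑ x ∈ Finset.univ.filter (fun x => β x = y₂), ∑ x' ∈ Finset.univ.filter (fun x' => β x' = y₁), ∑ x'' ∈ Finset.univ.filter (fun x'' => β x'' = y₃), K3 x x' x'') *
        (ϑc y₁ y₂ * ϑc y₁ y₃ * ϑc y₂ y₃) ≤ |t| ^ 3 * n * M ^ 3 * κ₃ := by
  simp_rw [fibre_sum3_swap12 β K3 _ y₁]
  exact weighted_coarse_k3_letter_le β hfib (fun a b c => K3 b a c) (fun a b c => hK b a c) hM hϑ0 hϑc0 hϑ hκ hk3 t y₁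

/-- **ORDER 3, THIRD INDEX FIXED** (the slot shape of `k3cϑ`): fine letter `Σ_{y,z}K3 y z v·ϑ(v,y)ϑ(v,z)ϑ(y,z) ≤ κ₃` (`v` fixed) gives the
coarse letter `Σ_{y₂,y₃}K3′(y₂,y₃,y₁)·ϑc(y₁,y₂)ϑc(y₁,y₃)ϑc(y₂,y₃) ≤ |t|³·n·M³·κ₃`. [folklore] -/
theorem weighted_coarse_k3_letter_le_third (β : ι → ι') {n : ℕ} (hfib : ∀ y, (univ.filter fun x => β x = y).card ≤ n)
    (K3 : ι → ι → ι → ℝ) (hK : ∀ x y v, 0 ≤ K3 x y v) {ϑ : ι → ι → ℝ} {ϑc : ι' → ι' → ℝ} {M κ₃ : ℝ} (hM : 0 ≤ M) (hϑ0 : ∀ x x', 0 ≤ ϑ x x')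
    (hϑc0 : ∀ y y', 0 ≤ ϑc y y') (hϑ : ∀ x x', ϑc (β x) (β x') ≤ M * ϑ x x') (hκ : 0 ≤ κ₃)
    (hk3 : ∀ v, ∑ y, ∑ z, K3 y z v * (ϑ v y * ϑ v z * ϑ y z) ≤ κ₃) (t : ℝ) (y₁ : ι') :
    ∑ y₂, ∑ y₃, (|t| ^ 3 * ∑ x ∈ Finset.univ.filter (fun x => β x = y₂), ∑ x' ∈ Finset.univ.filter (fun x' => β x' = y₃), ∑ x'' ∈ Finset.univ.filter (fun x'' => β x'' = y₁), K3 x x' x'') *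
        (ϑc y₁ y₂ * ϑc y₁ y₃ * ϑc y₂ y₃) ≤ |t| ^ 3 * n * M ^ 3 * κ₃ := by
  simp_rw [fibre_sum3_cycle β K3 _ _ y₁]
  exact weighted_coarse_k3_letter_le β hfib (fun a b c => K3 b c a) (fun a b c => hK b c a) hM hϑ0 hϑc0 hϑ hκ hk3 t y₁

/-! ## Toy -/

/-- Toy (the commuting fibre sums on numbers): `Σ_{i<2}Σ_{j<3} (i+j) = Σ_{j<3}Σ_{i<2} (i+j)`. -/
example : ∑ i ∈ Finset.range 2, ∑ j ∈ Finset.range 3, (i + j) = ∑ j ∈ Finset.range 3, ∑ i ∈ Finset.range 2, (i + j) := Finset.sum_comm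

end Summit.QuantumFields.BalabanUV.T4Continuum.NE7b.SupWeightedKernelLetterTransportTwo

end
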